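import Literature.Probability.Process.ContinuousOptionalSampling
import HarnessLib

/-!
# Pulling an `𝓕_ρ`-measurable weight out of a stopped martingale increment

Topic `Probability/Process`; generic (raw filtration of `ℝ≥0`, no usual conditions); theorems only.
For a real martingale `M` with a.s. continuous paths, stopping times `ρ ≤ σ` and a bounded
`𝓕_ρ`-measurable real weight `ξ`, the process

  `t ↦ ξ · (M^σ_t − M^ρ_t)`

is an a.e. martingale (`IsAEMartingale`): the elementary stochastic integral of the simple predictable
integrand `ξ 𝟙_{(ρ, σ]}` (Le Gall (2016), proof of Thm. 4.8 / Prop. 4.7 (ii); Revuz–Yor (1999), Ch. IV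
(2.3)). Proof: for `s ≤ t` and `A ∈ 𝓕_s` split `A = (A ∩ {ρ ≤ s}) ∪ (A ∩ {s < ρ})`; on the first part the
weight `𝟙_A ξ 𝟙_{ρ ≤ s}` is `𝓕_s`-measurable and `M^σ − M^ρ` is an a.e. martingale
(`Martingale.isAEMartingale_stoppedProcess`); on the second part the increment vanishes at time `s` and
`A ∩ {s < ρ} ∈ 𝓕_ρ`, so optional sampling between `ρ ≤ σ` (`setIntegral_stoppedProcess_eq_of_le`,
`integral_mul_eq_zero_of_setIntegral_eq_zero`) kills the time-`t` term.

## References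

* J.-F. Le Gall, *Brownian Motion, Martingales, and Stochastic Calculus* (2016), Prop. 4.7, Thm. 4.8,
  Cor. 3.23. [Legall2016]
* D. Revuz, M. Yor, *Continuous Martingales and Brownian Motion* (1999), Ch. IV (2.3), Ch. II (3.2).
  [RevuzYor1999]
-/

noncomputable section

open MeasureTheory Filter Topology Set
open scoped NNReal ENNReal

namespace Literature.Probability.Process

variable {Ω : Type*} {mΩ : MeasurableSpace Ω} {P : Measure Ω} {𝓕 : Filtration ℝ≥0 mΩ}

/-- For a stopping time `ρ`, an `𝓕 s`-measurable set cut down to `{s < ρ}` is `𝓕_ρ`-measurable. [folklore] -/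
theorem measurableSet_inter_lt_of_isStoppingTime {ρ : Ω → WithTop ℝ≥0} (hρ : IsStoppingTime 𝓕 ρ) {s : ℝ≥0}
    {A : Set Ω} (hA : MeasurableSet[𝓕 s] A) :
    MeasurableSet[hρ.measurableSpace] (A ∩ {ω | (s : WithTop ℝ≥0) < ρ ω}) := by
  have hlt : MeasurableSet[𝓕 s] {ω | (s : WithTop ℝ≥0) < ρ ω} := hρ.measurableSet_gt s
  refine ⟨𝓕.le s _ (@MeasurableSet.inter _ (𝓕 s) _ _ hA hlt), fun i ↦ ?_⟩
  by_cases hsi : s ≤ i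
  · exact @MeasurableSet.inter _ (𝓕 i) _ _ (@MeasurableSet.inter _ (𝓕 i) _ _ (𝓕.mono hsi _ hA) (𝓕.mono hsi _ hlt))
      (hρ.measurableSet_le i)
  · have : A ∩ {ω | (s : WithTop ℝ≥0) < ρ ω} ∩ {ω | ρ ω ≤ i} = ∅ := by
      ext ω
      simp only [mem_inter_iff, mem_setOf_eq, mem_empty_iff_false, iff_false, not_and, and_imp]
      intro _ h1 h2
      exact hsi (WithTop.coe_le_coe.1 (h1.le.trans h2))
    rw [this]
    exact @MeasurableSet.empty _ (𝓕 i)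

/-- An `𝓕_ρ`-measurable real weight cut down to `{ρ ≤ t}` is `𝓕 t`-measurable. [folklore] -/
theorem measurable_indicator_le_of_isStoppingTime {ρ : Ω → WithTop ℝ≥0} (hρ : IsStoppingTime 𝓕 ρ)
    {ξ : Ω → ℝ} (hξ : Measurable[hρ.measurableSpace] ξ) (t : ℝ≥0) :
    Measurable[𝓕 t] ({ω | ρ ω ≤ t}.indicator ξ) := by
  intro B hB
  rw [Set.indicator_preimage, Set.ite]
  refine @MeasurableSet.union _ (𝓕 t) _ _ ((hξ hB).2 t) (@MeasurableSet.diff _ (𝓕 t) _ _ ?_ (hρ.measurableSet_le t))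
  by_cases h0 : (0 : ℝ) ∈ B
  · have : (0 : Ω → ℝ) ⁻¹' B = univ := eq_univ_of_forall fun _ ↦ h0
    rw [this]; exact @MeasurableSet.univ _ (𝓕 t)
  · have : (0 : Ω → ℝ) ⁻¹' B = ∅ := eq_empty_of_forall_notMem fun _ h ↦ h0 h
    rw [this]; exact @MeasurableSet.empty _ (𝓕 t)

/-- **Pulling an `𝓕_ρ`-measurable bounded weight out of a stopped martingale increment**: for a martingale
`M` with a.s. continuous paths, stopping times `ρ ≤ σ` and a bounded `𝓕_ρ`-measurable real `ξ`, the process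
`ξ (M^σ_t − M^ρ_t)` is an a.e. martingale. [cite: Legall2016, Prop. 4.7 and Thm. 4.8 (proof)] -/
theorem isAEMartingale_mul_stoppedProcess_sub [IsFiniteMeasure P] {M : ℝ≥0 → Ω → ℝ} (hM : Martingale M 𝓕 P)
    (hcont : ∀ᵐ ω ∂P, Continuous (M · ω)) {ρ σ : Ω → WithTop ℝ≥0} (hρ : IsStoppingTime 𝓕 ρ)
    (hσ : IsStoppingTime 𝓕 σ) (hle : ρ ≤ σ) {ξ : Ω → ℝ} (hξ : Measurable[hρ.measurableSpace] ξ) {C : ℝ}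
    (hC : ∀ ω, |ξ ω| ≤ C) :
    IsAEMartingale (fun t ω ↦ ξ ω * (stoppedProcess M σ t ω - stoppedProcess M ρ t ω)) 𝓕 P := by
  set D : ℝ≥0 → Ω → ℝ := fun t ω ↦ stoppedProcess M σ t ω - stoppedProcess M ρ t ω with hDdef
  have hD : IsAEMartingale D 𝓕 P :=
    (hM.isAEMartingale_stoppedProcess hcont hσ.isOptionalTime).sub (hM.isAEMartingale_stoppedProcess hcont hρ.isOptionalTime)
  have hD0 : ∀ (t : ℝ≥0) ω, (t : WithTop ℝ≥0) ≤ ρ ω → D t ω = 0 := fun t ω ht ↦ by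
    simp only [hDdef, stoppedProcess_eq_of_le ht, stoppedProcess_eq_of_le (ht.trans (hle ω)), sub_self]
  have hξm : Measurable ξ := hξ.mono hρ.measurableSpace_le le_rfl
  have hξt := measurable_indicator_le_of_isStoppingTime hρ hξ
  -- `ξ D_t = (ξ 𝟙_{ρ ≤ t}) D_t`
  have hprod : ∀ t ω, ξ ω * D t ω = {ω | ρ ω ≤ t}.indicator ξ ω * D t ω := fun t ω ↦ by
    by_cases h : ρ ω ≤ t
    · rw [indicator_of_mem (show ω ∈ {ω | ρ ω ≤ (t : WithTop ℝ≥0)} from h)]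
    · rw [indicator_of_notMem (show ω ∉ {ω | ρ ω ≤ (t : WithTop ℝ≥0)} from h), hD0 t ω (not_le.1 h).le, mul_zero,
        zero_mul]
  have hmeas : ∀ t, AEStronglyMeasurable[𝓕 t] (fun ω ↦ ξ ω * D t ω) P := fun t ↦ by
    have h1 : AEStronglyMeasurable[𝓕 t] (fun ω ↦ {ω | ρ ω ≤ t}.indicator ξ ω * D t ω) P :=
      (hξt t).stronglyMeasurable.aestronglyMeasurable.mul (hD.aestronglyMeasurable t)
    exact h1.congr (Eventually.of_forall fun ω ↦ (hprod t ω).symm)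
  have hbdd : ∀ ω, ‖ξ ω‖ ≤ C := fun ω ↦ by rw [Real.norm_eq_abs]; exact hC ω
  have hint : ∀ t, Integrable (fun ω ↦ ξ ω * D t ω) P := fun t ↦
    (hD.integrable t).bdd_mul hξm.aestronglyMeasurable (ae_of_all _ hbdd)
  refine IsAEMartingale.of_setIntegral_eq hmeas hint fun s t hst A hA ↦ ?_
  have hAm : MeasurableSet A := 𝓕.le s _ hA
  -- the two weights
  set G₁ : Ω → ℝ := fun ω ↦ A.indicator (fun _ ↦ (1 : ℝ)) ω * {ω | ρ ω ≤ s}.indicator ξ ω with hG₁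
  set G₂ : Ω → ℝ := (A ∩ {ω | (s : WithTop ℝ≥0) < ρ ω}).indicator ξ with hG₂
  have hsplit : ∀ r ω, A.indicator (fun ω ↦ ξ ω * D r ω) ω = G₁ ω * D r ω + G₂ ω * D r ω := by
    intro r ω
    by_cases hωA : ω ∈ A
    · by_cases hρs : ρ ω ≤ s
      · have h2 : ω ∉ A ∩ {ω | (s : WithTop ℝ≥0) < ρ ω} := fun h ↦ (not_lt.2 hρs) h.2
        simp only [hG₁, hG₂, indicator_of_mem hωA, indicator_of_mem (show ω ∈ {ω | ρ ω ≤ (s : WithTop ℝ≥0)} from hρs),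
          indicator_of_notMem h2, one_mul, zero_mul, add_zero]
      · have h2 : ω ∈ A ∩ {ω | (s : WithTop ℝ≥0) < ρ ω} := ⟨hωA, not_le.1 hρs⟩
        simp only [hG₁, hG₂, indicator_of_mem hωA, indicator_of_notMem (show ω ∉ {ω | ρ ω ≤ (s : WithTop ℝ≥0)} from hρs),
          indicator_of_mem h2, mul_zero, zero_mul, zero_add]
    · have h2 : ω ∉ A ∩ {ω | (s : WithTop ℝ≥0) < ρ ω} := fun h ↦ hωA h.1
      simp only [hG₁, hG₂, indicator_of_notMem hωA, indicator_of_notMem h2, zero_mul, add_zero]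
  -- part 1: `G₁` is a bounded `𝓕 s`-measurable weight and `D` an a.e. martingale
  have hG₁m : AEStronglyMeasurable[𝓕 s] G₁ P :=
    ((stronglyMeasurable_const.indicator hA).mul (hξt s).stronglyMeasurable).aestronglyMeasurable
  have hG₁b : ∀ᵐ ω ∂P, ‖G₁ ω‖ ≤ C := ae_of_all _ fun ω ↦ by
    have hC0 : 0 ≤ C := (abs_nonneg _).trans (hC ω)
    have hind : |{ω | ρ ω ≤ (s : WithTop ℝ≥0)}.indicator ξ ω| ≤ C := by
      by_cases h2 : ω ∈ {ω | ρ ω ≤ (s : WithTop ℝ≥0)}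
      · rw [indicator_of_mem h2]; exact hC ω
      · rw [indicator_of_notMem h2, abs_zero]; exact hC0
    simp only [hG₁]
    rw [Real.norm_eq_abs, abs_mul]
    by_cases h1 : ω ∈ A
    · rw [indicator_of_mem h1, abs_one, one_mul]; exact hind
    · rw [indicator_of_notMem h1, abs_zero, zero_mul]; exact hC0
  have e1 : ∫ ω, G₁ ω * D t ω ∂P = ∫ ω, G₁ ω * D s ω ∂P := hD.integral_mul_eq hst hG₁m hG₁b
  -- part 2: `G₂` is `𝓕_ρ`-measurable, `D s = 0` on its support, optional sampling kills the time-`t` term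
  have hG₂m : Measurable[hρ.measurableSpace] G₂ := hξ.indicator (measurableSet_inter_lt_of_isStoppingTime hρ hA)
  have hG₂b : ∀ ω, ‖G₂ ω‖ ≤ C := fun ω ↦ by
    rw [hG₂, norm_indicator_eq_indicator_norm]
    exact (indicator_le_self' (fun _ _ ↦ norm_nonneg _) ω).trans (hbdd ω)
  have e2s : ∫ ω, G₂ ω * D s ω ∂P = 0 := by
    refine integral_eq_zero_of_ae (ae_of_all _ fun ω ↦ ?_)
    by_cases h : ω ∈ A ∩ {ω | (s : WithTop ℝ≥0) < ρ ω}
    · simp only [hD0 s ω h.2.le, mul_zero, Pi.zero_apply]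
    · simp only [hG₂, indicator_of_notMem h, zero_mul, Pi.zero_apply]
  have e2t : ∫ ω, G₂ ω * D t ω ∂P = 0 := by
    have h0 : ∀ A', MeasurableSet[hρ.measurableSpace] A' → ∫ ω in A', D t ω ∂P = 0 := by
      intro A' hA'
      have hi1 := (hM.isAEMartingale_stoppedProcess hcont hσ.isOptionalTime).integrable t
      have hi2 := (hM.isAEMartingale_stoppedProcess hcont hρ.isOptionalTime).integrable t
      simp only [hDdef]
      rw [integral_sub hi1.integrableOn hi2.integrableOn, setIntegral_stoppedProcess_eq_of_le hM hcont hρ hσ hle hA' t,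
        sub_self]
    have hG₂c : AEStronglyMeasurable[hρ.measurableSpace] (fun ω ↦ (G₂ ω : ℂ)) P :=
      (Complex.measurable_ofReal.comp hG₂m).aestronglyMeasurable
    have hG₂cb : ∀ᵐ ω ∂P, ‖(G₂ ω : ℂ)‖ ≤ C := ae_of_all _ fun ω ↦ by rw [Complex.norm_real]; exact hG₂b ω
    have h := integral_mul_eq_zero_of_setIntegral_eq_zero hρ.measurableSpace_le (hD.integrable t) h0 hG₂c hG₂cb
    have heq : ∫ ω, (G₂ ω : ℂ) * (D t ω : ℂ) ∂P = ((∫ ω, G₂ ω * D t ω ∂P : ℝ) : ℂ) := by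
      rw [← integral_complex_ofReal]; push_cast; rfl
    rw [heq] at h
    exact_mod_cast h
  -- assemble
  have hi : ∀ r, Integrable (fun ω ↦ G₁ ω * D r ω) P := fun r ↦
    (hD.integrable r).bdd_mul (hG₁m.mono (𝓕.le s)) hG₁b
  have hi' : ∀ r, Integrable (fun ω ↦ G₂ ω * D r ω) P := fun r ↦
    (hD.integrable r).bdd_mul (hG₂m.mono hρ.measurableSpace_le le_rfl).aestronglyMeasurable (ae_of_all _ hG₂b)
  have key : ∀ r, ∫ ω in A, ξ ω * D r ω ∂P = ∫ ω, G₁ ω * D r ω ∂P + ∫ ω, G₂ ω * D r ω ∂P := fun r ↦ by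
    rw [← integral_indicator hAm, ← integral_add (hi r) (hi' r)]
    exact integral_congr_ae (ae_of_all _ fun ω ↦ hsplit r ω)
  change ∫ ω in A, ξ ω * D s ω ∂P = ∫ ω in A, ξ ω * D t ω ∂P
  rw [key, key, e1, e2s, e2t]

end Literature.Probability.Process

end
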